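import Mathlib
import Summits.ValiantsHypothesis.ValiantsHypothesis.Theorems.LiouvilleSarnakLiouvilleCutRankMonochromaticRectangles
import HarnessLib

/-!
# Route LiouvilleSarnak — crux `LiouvilleCutRank` (stmt-ValiantsHypothesis-14775):
# the crux IS «deterministic communication complexity → ∞» — monochromatic RECTANGLE PARTITIONS

`Theorems/LiouvilleSarnakLiouvilleCutRankMonochromaticRectangles.lean` introduced the rung NCR (no large
`λ`-monochromatic digital rectangle) between the two cruxes.  This file makes the communication-complexity
reading of the rank crux itself exact: for the `2^n × 2^n` Liouville cut matrices `M_π(r,c) = λ(N_π(r,c)+1)`,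
«`rank M_π → ∞` uniformly in the balanced cut `π`» is EQUIVALENT to «the least number of `λ`-MONOCHROMATIC
digital rectangles PARTITIONING `{0,1}^n × {0,1}^n` tends to infinity uniformly in `π`» — the leaf count of an
optimal deterministic two-party protocol for `λ(1 + N)` when one player holds the row digits and the other the
column digits.

* ★ `rank_le_card_of_monochromaticPartition` — a matrix partitioned into monochromatic rectangles
  `I_t × J_t` (`t ∈ ι`, every cell in exactly one rectangle, `A = s_t` on the `t`-th) has `rank ≤ |ι|`:
  `A = Σ_t s_t · 1_{I_t} 1_{J_t}ᵀ` is a sum of `|ι|` matrices of rank `≤ 1` (`rank_sum_le`).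
* ★ `exists_monochromaticGrid` — conversely a `±1` matrix (field, `2 ≠ 0`) has a GRID partition — row classes
  `×` column classes, at most `2^{rank}` of each (`LiouvilleSarnakAligned.card_image_row_le_two_pow_rank`) — all
  of whose `≤ 4^{rank}` cells are monochromatic.
* ★★ `liouvilleCutRank_iff_partitionNumber_unbounded` — `LiouvilleCutRank ↔ ∀ D ∃ n₀ ∀ n ≥ n₀ ∀ π`, every
  partition of `{0,1}^n × {0,1}^n` into `λ`-monochromatic digital rectangles has more than `D` pieces.
* `partitionNumber_unbounded_of_noLargeMonochromaticRectangle` — NCR ⇒ the partition form directly (the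
  pieces have total area `4^n`, each `< 4^n / D`), recovering
  `MonochromaticRectangles.liouvilleCutRank_of_noLargeMonochromaticRectangle` through the equivalence.

Dictionary (honest placement).  The four classical lower-bound methods of deterministic communication
complexity are now all typed on this crux: RANK (the crux itself), FOOLING SETS (pairwise-separated prefix
rows: `…CertifiedCutPoints`, `…RatioWitness`, `…ShiftCertificates`), the RECTANGLE-SIZE bound (NCR,
`…MonochromaticRectangles`) and DISCREPANCY (`Rectangles.digitalBilinearLiouville_iff_rectangles`, i.e. the
crux `DigitalBilinearLiouville`).  `LiouvilleCutRank`, `DigitalBilinearLiouville`, `AlgebraicSarnak` stay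
OPEN; nothing here bears on `VP ≠ VNP`.  No definitions (partitions are written out in the theorem types).
-/

set_option linter.dupNamespace false

noncomputable section

namespace Summit.ValiantsHypothesis.ValiantsHypothesis.Theorems.LiouvilleSarnakLiouvilleCutRank.RectanglePartition

open ArithmeticFunction Finset

open Summit.ValiantsHypothesis.ValiantsHypothesis.Theses.LiouvilleSarnak (LiouvilleCutRank)
open Summit.ValiantsHypothesis.ValiantsHypothesis.Theorems.LiouvilleSarnakAligned
  (card_image_row_le_two_pow_rank)
open Summit.ValiantsHypothesis.ValiantsHypothesis.Theorems.LiouvilleSarnakLiouvilleCutRank.MonochromaticRectangles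
  (cutMatrix_entry_eq_or)

/-! ### §1 Rank is subadditive; a monochromatic partition bounds the rank -/

/-- `rank (Σ_{t ∈ s} A_t) ≤ Σ_{t ∈ s} rank A_t`. [folklore] -/
theorem rank_sum_le {K : Type*} [Field K] {m n ι : Type*} [Fintype m] [Fintype n] [DecidableEq ι]
    (s : Finset ι) (f : ι → Matrix m n K) :
    (∑ t ∈ s, f t).rank ≤ ∑ t ∈ s, (f t).rank := by
  induction s using Finset.induction_on with
  | empty => simp [Matrix.rank_zero]
  | insert a s ha ih =>
    rw [sum_insert ha, sum_insert ha]
    -- `rank (A + B) ≤ rank A + rank B` (the tree's `SOSBilinearCalibration.rank_add_le`, inlined to keep the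
    -- import cone small): the range of `A + B` lies in the sum of the ranges
    have hadd : (f a + ∑ t ∈ s, f t).rank ≤ (f a).rank + (∑ t ∈ s, f t).rank := by
      unfold Matrix.rank
      rw [Matrix.mulVecLin_add]
      exact (Submodule.finrank_mono (LinearMap.range_add_le _ _)).trans
        (Submodule.finrank_add_le_finrank_add_finrank _ _)
    exact hadd.trans (Nat.add_le_add_left ih _)

/-- ★ **A monochromatic rectangle partition bounds the rank.**  If the cells of `A` are partitioned into
rectangles `I_t × J_t`, `t ∈ ι` (each cell in exactly one of them), and `A` is constant `= s_t` on the `t`-th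
rectangle, then `rank A ≤ |ι|`: `A = Σ_t s_t · 1_{I_t} 1_{J_t}ᵀ`, a sum of `|ι|` rank-`≤ 1` matrices.
[folklore; cf. Kushilevitz–Nisan, *Communication Complexity*, §1.4] -/
theorem rank_le_card_of_monochromaticPartition {K : Type*} [Field K] {m n : Type*} [Fintype m] [Fintype n]
    [DecidableEq m] [DecidableEq n] {ι : Type*} [Fintype ι]
    (A : Matrix m n K) (I : ι → Finset m) (J : ι → Finset n) (s : ι → K)
    (hcover : ∀ i j, ∃! t, i ∈ I t ∧ j ∈ J t)
    (hmono : ∀ t, ∀ i ∈ I t, ∀ j ∈ J t, A i j = s t) :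
    A.rank ≤ Fintype.card ι := by
  classical
  have hA : A = ∑ t, Matrix.vecMulVec (fun i => if i ∈ I t then s t else 0)
      (fun j => if j ∈ J t then (1 : K) else 0) := by
    ext i j
    obtain ⟨t₀, ⟨hi, hj⟩, huniq⟩ := hcover i j
    rw [Matrix.sum_apply, Finset.sum_eq_single t₀]
    · simp [Matrix.vecMulVec_apply, hi, hj, hmono t₀ i hi j hj]
    · intro t _ ht
      rw [Matrix.vecMulVec_apply]
      by_cases h1 : i ∈ I t
      · by_cases h2 : j ∈ J t
        · exact absurd (huniq t ⟨h1, h2⟩) ht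
        · simp [h2]
      · simp [h1]
    · intro h; exact absurd (mem_univ _) h
  calc A.rank = (∑ t, Matrix.vecMulVec (fun i => if i ∈ I t then s t else 0)
        (fun j => if j ∈ J t then (1 : K) else 0)).rank := by rw [← hA]
    _ ≤ ∑ t, (Matrix.vecMulVec (fun i => if i ∈ I t then s t else 0)
        (fun j => if j ∈ J t then (1 : K) else 0)).rank := rank_sum_le _ _
    _ ≤ ∑ _t : ι, 1 := sum_le_sum fun t _ => Matrix.rank_vecMulVec_le _ _
    _ = Fintype.card ι := by simp

/-! ### §2 Bounded rank gives a small monochromatic grid -/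

/-- ★ **The class grid.**  A `±1` matrix over a field with `2 ≠ 0` admits a partition of its rows into
`≤ 2^{rank}` classes and of its columns into `≤ 2^{rank}` classes (equal rows, resp. equal columns) such that
`A` is constant on every cell `I × J` of the grid. [folklore] -/
theorem exists_monochromaticGrid {K : Type*} [Field K] [NeZero (2 : K)] [DecidableEq K]
    {m n : Type*} [Fintype m] [Fintype n] [DecidableEq m] [DecidableEq n]
    (A : Matrix m n K) (hA : ∀ i j, A i j = 1 ∨ A i j = -1) :
    ∃ (Rows : Finset (Finset m)) (Cols : Finset (Finset n)),
      Rows.card ≤ 2 ^ A.rank ∧ Cols.card ≤ 2 ^ A.rank ∧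
      (∀ i, ∃! I, I ∈ Rows ∧ i ∈ I) ∧ (∀ j, ∃! J, J ∈ Cols ∧ j ∈ J) ∧
      (∀ I ∈ Rows, ∀ J ∈ Cols, ∀ i ∈ I, ∀ i' ∈ I, ∀ j ∈ J, ∀ j' ∈ J, A i j = A i' j') := by
  classical
  refine ⟨(univ.image fun i => A i).image (fun v => univ.filter fun i => A i = v),
    (univ.image fun j => A.transpose j).image (fun v => univ.filter fun j => A.transpose j = v),
    ?_, ?_, ?_, ?_, ?_⟩
  · exact card_image_le.trans (card_image_row_le_two_pow_rank A hA)
  · refine card_image_le.trans ?_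
    have h := card_image_row_le_two_pow_rank A.transpose (fun j i => hA i j)
    rwa [Matrix.rank_transpose] at h
  · intro i
    refine ⟨univ.filter fun i' => A i' = A i, ⟨?_, by simp⟩, ?_⟩
    · exact mem_image.mpr ⟨A i, mem_image.mpr ⟨i, mem_univ _, rfl⟩, rfl⟩
    · rintro I ⟨hI, hiI⟩
      obtain ⟨v, -, rfl⟩ := mem_image.mp hI
      simp only [mem_filter, mem_univ, true_and] at hiI
      rw [hiI]
  · intro j
    refine ⟨univ.filter fun j' => A.transpose j' = A.transpose j, ⟨?_, by simp⟩, ?_⟩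
    · exact mem_image.mpr ⟨A.transpose j, mem_image.mpr ⟨j, mem_univ _, rfl⟩, rfl⟩
    · rintro J ⟨hJ, hjJ⟩
      obtain ⟨v, -, rfl⟩ := mem_image.mp hJ
      simp only [mem_filter, mem_univ, true_and] at hjJ
      rw [hjJ]
  · intro I hI J hJ i hi i' hi' j hj j' hj'
    obtain ⟨v, -, rfl⟩ := mem_image.mp hI
    obtain ⟨v', -, rfl⟩ := mem_image.mp hJ
    simp only [mem_filter, mem_univ, true_and] at hi hi' hj hj'
    have h1 : A i j = A i' j := by rw [congrFun hi j, congrFun hi' j]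
    have h2 : A i' j = A i' j' := by
      have e1 := congrFun hj i'
      have e2 := congrFun hj' i'
      simp only [Matrix.transpose_apply] at e1 e2
      rw [e1, e2]
    rw [h1, h2]

/-! ### §3 The crux ⟺ unbounded monochromatic partition number -/

/-- ★★ **`LiouvilleCutRank` ⟺ the communication complexity of `λ(1 + N_π)` is unbounded.**  The crux holds
iff for every `D` and all large `n`, under every balanced cut `π` of the `2n` bit positions, every partition of
`{0,1}^n × {0,1}^n` into `λ`-monochromatic digital rectangles `I_t ×_π J_t` (`t ∈ ι`; each pair `(r,c)` in
exactly one rectangle, `λ(N_π(r,c)+1) = s_t` there) has more than `D` pieces.  (`⇒`: `rank ≤ |ι|`;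
`⇐`: a cut of rank `< W` has the class grid with `≤ 4^{W}` monochromatic cells.) [this file] -/
theorem liouvilleCutRank_iff_partitionNumber_unbounded :
    LiouvilleCutRank ↔
      ∀ D : ℕ, ∃ n₀ : ℕ, ∀ n ≥ n₀, ∀ π : Fin n ⊕ Fin n ≃ Fin (2 * n),
        ∀ (ι : Type) [Fintype ι] (I J : ι → Finset (Fin n → Bool)) (s : ι → ℤ),
          (∀ r c : Fin n → Bool, ∃! t, r ∈ I t ∧ c ∈ J t) →
          (∀ t, ∀ r ∈ I t, ∀ c ∈ J t,
            liouville (Nat.ofBits (fun j : Fin (2 * n) => Sum.elim r c (π.symm j)) + 1) = s t) →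
          D < Fintype.card ι := by
  classical
  constructor
  · intro h D
    obtain ⟨n₀, hn₀⟩ := h (D + 1)
    refine ⟨n₀, fun n hn π ι _ I J s hcover hmono => ?_⟩
    have hrank := hn₀ n hn π
    have hle := rank_le_card_of_monochromaticPartition
      (Matrix.of fun r c : Fin n → Bool =>
        (((liouville (Nat.ofBits (fun j : Fin (2 * n) => Sum.elim r c (π.symm j)) + 1) : ℤ) : ℂ)))
      I J (fun t => ((s t : ℤ) : ℂ)) hcover
      (fun t r hr c hc => by rw [Matrix.of_apply, hmono t r hr c hc])
    omega
  · intro h W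
    obtain ⟨n₀, hn₀⟩ := h (4 ^ W)
    refine ⟨n₀, fun n hn π => ?_⟩
    set M := (Matrix.of fun r c : Fin n → Bool =>
      (((liouville (Nat.ofBits (fun j : Fin (2 * n) => Sum.elim r c (π.symm j)) + 1) : ℤ) : ℂ))) with hM
    obtain ⟨Rows, Cols, hR, hC, hRu, hCu, hconst⟩ := exists_monochromaticGrid M (cutMatrix_entry_eq_or n π)
    -- the grid as an indexed monochromatic partition
    have key := hn₀ n hn π (↥Rows × ↥Cols) (fun p => p.1.1) (fun p => p.2.1)
      (fun p => if hp : (p.1.1 ×ˢ p.2.1).Nonempty then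
        liouville (Nat.ofBits (fun j : Fin (2 * n) => Sum.elim hp.choose.1 hp.choose.2 (π.symm j)) + 1)
        else 1)
      (fun r c => by
        obtain ⟨I, ⟨hI, hrI⟩, hIu⟩ := hRu r
        obtain ⟨J, ⟨hJ, hcJ⟩, hJu⟩ := hCu c
        refine ⟨(⟨I, hI⟩, ⟨J, hJ⟩), ⟨hrI, hcJ⟩, ?_⟩
        rintro ⟨⟨I', hI'⟩, ⟨J', hJ'⟩⟩ ⟨hrI', hcJ'⟩
        have e1 : I' = I := hIu I' ⟨hI', hrI'⟩
        have e2 : J' = J := hJu J' ⟨hJ', hcJ'⟩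
        subst e1 e2
        rfl)
      (fun p r hr c hc => by
        have hp : (p.1.1 ×ˢ p.2.1).Nonempty := ⟨(r, c), mem_product.mpr ⟨hr, hc⟩⟩
        rw [dif_pos hp]
        have hmem := mem_product.mp hp.choose_spec
        have e := hconst p.1.1 p.1.2 p.2.1 p.2.2 r hr hp.choose.1 hmem.1 c hc hp.choose.2 hmem.2
        rw [hM, Matrix.of_apply, Matrix.of_apply] at e
        exact_mod_cast e)
    -- `4^W < |Rows| · |Cols| ≤ 4^{rank}`
    rw [Fintype.card_prod, Fintype.card_coe, Fintype.card_coe] at key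
    have h4 : 4 ^ W < 4 ^ M.rank := by
      calc 4 ^ W < Rows.card * Cols.card := key
        _ ≤ 2 ^ M.rank * 2 ^ M.rank := Nat.mul_le_mul hR hC
        _ = 4 ^ M.rank := by rw [← mul_pow]; norm_num
    exact ((Nat.pow_lt_pow_iff_right (by norm_num)).mp h4).le

/-! ### §4 NCR in partition currency -/

/-- **NCR ⇒ unbounded partition number, directly** (no rank): the pieces of a monochromatic partition have
total area `4^n`, and under NCR each has area `< 4^n / D`, so there are more than `D` of them.  Together with
`liouvilleCutRank_iff_partitionNumber_unbounded` this re-proves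
`MonochromaticRectangles.liouvilleCutRank_of_noLargeMonochromaticRectangle`. [this file] -/
theorem partitionNumber_unbounded_of_noLargeMonochromaticRectangle
    (h : ∀ D : ℕ, ∃ n₀ : ℕ, ∀ n ≥ n₀, ∀ π : Fin n ⊕ Fin n ≃ Fin (2 * n),
      ∀ (K K' : Finset (Fin n → Bool)) (s : ℤ), (s = 1 ∨ s = -1) →
        (∀ r ∈ K, ∀ c ∈ K',
          liouville (Nat.ofBits (fun j : Fin (2 * n) => Sum.elim r c (π.symm j)) + 1) = s) →
        K.card * K'.card * D < 4 ^ n) :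
    ∀ D : ℕ, ∃ n₀ : ℕ, ∀ n ≥ n₀, ∀ π : Fin n ⊕ Fin n ≃ Fin (2 * n),
      ∀ (ι : Type) [Fintype ι] (I J : ι → Finset (Fin n → Bool)) (s : ι → ℤ),
        (∀ r c : Fin n → Bool, ∃! t, r ∈ I t ∧ c ∈ J t) →
        (∀ t, ∀ r ∈ I t, ∀ c ∈ J t,
          liouville (Nat.ofBits (fun j : Fin (2 * n) => Sum.elim r c (π.symm j)) + 1) = s t) →
        D < Fintype.card ι := by
  classical
  intro D
  obtain ⟨n₀, hn₀⟩ := h D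
  refine ⟨n₀, fun n hn π ι _ I J s hcover hmono => ?_⟩
  -- the cell map and its fibres
  let cell : (Fin n → Bool) × (Fin n → Bool) → ι := fun p => (hcover p.1 p.2).choose
  have hcell : ∀ p : (Fin n → Bool) × (Fin n → Bool), ∀ t, cell p = t ↔ (p.1 ∈ I t ∧ p.2 ∈ J t) := by
    intro p t
    have hspec := (hcover p.1 p.2).choose_spec
    constructor
    · rintro rfl; exact hspec.1
    · intro ht; exact ((hcover p.1 p.2).unique ht hspec.1).symm ▸ rfl
  have hfib : ∀ t, (univ.filter fun p : (Fin n → Bool) × (Fin n → Bool) => cell p = t) = I t ×ˢ J t := by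
    intro t; ext p
    simp only [mem_filter, mem_univ, true_and, mem_product]
    exact hcell p t
  -- total area
  have harea : ∑ t, (I t).card * (J t).card = 4 ^ n := by
    have h1 := card_eq_sum_card_fiberwise (f := cell) (s := (univ : Finset ((Fin n → Bool) × (Fin n → Bool))))
      (t := univ) (fun _ _ => mem_univ _)
    simp only [hfib, card_product] at h1
    rw [← h1, card_univ, Fintype.card_prod, Fintype.card_fun, Fintype.card_bool, Fintype.card_fin, ← mul_pow]
    norm_num [pow_mul]
  -- each piece is small: `|I_t| |J_t| D < 4^n` (empty pieces trivially; nonempty pieces are `±1`-monochromatic)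
  have hsmall : ∀ t, (I t).card * (J t).card * D < 4 ^ n := by
    intro t
    by_cases hne : ((I t) ×ˢ (J t)).Nonempty
    · obtain ⟨⟨r, c⟩, hp⟩ := hne
      rw [mem_product] at hp
      have hs : s t = 1 ∨ s t = -1 := by
        rw [← hmono t r hp.1 c hp.2, liouville_apply (Nat.succ_ne_zero _)]
        exact neg_one_pow_eq_or ℤ _
      exact hn₀ n hn π (I t) (J t) (s t) hs (hmono t)
    · rw [not_nonempty_iff_eq_empty, product_eq_empty] at hne
      rcases hne with h0 | h0 <;> simp [h0]
  -- sum: `4^n · D = Σ_t |I_t||J_t| D < |ι| · 4^n`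
  by_contra hD
  rw [not_lt] at hD
  have hlt : ∑ t, (I t).card * (J t).card * D < ∑ _t : ι, 4 ^ n := by
    have hι : (univ : Finset ι).Nonempty := by
      by_contra hemp
      rw [not_nonempty_iff_eq_empty, univ_eq_empty_iff] at hemp
      have h0 : (4 : ℕ) ^ n = 0 := by rw [← harea]; exact sum_eq_zero fun t _ => (hemp.false t).elim
      exact absurd h0 (by positivity)
    exact sum_lt_sum_of_nonempty hι fun t _ => hsmall t
  rw [← sum_mul, harea, sum_const, card_univ, smul_eq_mul] at hlt
  have hle : Fintype.card ι * 4 ^ n ≤ 4 ^ n * D := by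
    rw [Nat.mul_comm (4 ^ n) D]; exact Nat.mul_le_mul_right _ hD
  omega

end Summit.ValiantsHypothesis.ValiantsHypothesis.Theorems.LiouvilleSarnakLiouvilleCutRank.RectanglePartition

end
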